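/-
Copyright (c) 2026 the pub-hodgecm-mathlib formalisation cell (harness21).  Prover seat hodgecm-mathlib-K2E1-p08 (g4), Track B ∕ K2-LIT, h413 =
`stmt-HodgeConjecture-24833`, line `K2_E1_TraceFormulaBeta`, campaign «RES-RANK-ONE»; DEAL (FD-ASSEMBLY) of the dealer K2E1-plan (g2) 2026-09-04T03:08:27Z on the
campaign page `K2/K2E1-p02/g4/SPEC-residual-rank-one.md` §5 (f925122a84d58d35): the file that turns the live sockets 5Res ∕ 12R3 into TWO print-named inputs —
(H4-a) REGULARITY (continuous representatives of the `K`-finite residual vectors) and (H4-b) EXPONENT FINITENESS (their constant terms lie in one finite-dimensional space).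
-/
import Summits.HodgeConjecture.HodgeConjecture.Theorems.K2E1ResidualCompactOfAdmissible   -- ★ p856793 (K2E1-p02 g4): `residualSpectrumCompact_of_admissible` (sockets ⟸ `hadm`)
import Summits.HodgeConjecture.HodgeConjecture.Theorems.K2E1BorelLeviU                    -- ★ p856972 (this seat): `isClosed_cmParabolicData(R)_radical_…` (+ the cocompact ★ files, p855468 `finiteCovolume_of_isCompact`)
import HarnessLib

/-!
# K2·E1 — `K2E1ResidualAdmissibleOfExponents`: (FD) «`L²_res(U(Φ_N))` IS `K`-ADMISSIBLE» — HENCE THE SOCKETS 5Res ∕ 12R3 — FROM (H4-a) REGULARITY AND (H4-b)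
# EXPONENT FINITENESS (campaign «RES-RANK-ONE», the assembly)

Track B ∕ K2-LIT, crux h413 = `stmt-HodgeConjecture-24833`, route of record `HCCMUnconditional`; cell `hodgecm-mathlib`, squad K2, ENGINE E1 (socket module
`K2_E1_TraceFormulaBetaSigs_GlobalIndex` ED. 12, live sockets 5Res `sig_K2E1ResidualCompactU2` :247 = ★ `CmResidualSpectrumCompact L 2 μ` and 12R3
`sig_K2E1ResidualCompactU3R` :293 = ★ `CmResidualSpectrumCompactR L 3 μ`).  Prover seat `hodgecm-mathlib-K2E1-p08` (g4); DEAL (FD-ASSEMBLY) of the dealer K2E1-plan (g2)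
2026-09-04T03:08:27Z, EXACTLY per K2E1-p02 (g4)'s campaign page §5.  THEOREMS ONLY (no `def`, no `instance`, no notation, no named-fact hypothesis, no `sorry`);
lane `--supports stmt-HodgeConjecture-24833 --as helper` (count-neutral).  CLOSES NO SOCKET: it makes 5Res ∕ 12R3 read «⟸ (H4-a) + (H4-b)», two print-named inputs.

THE TWO INPUTS (hypotheses, `def`-free; `S` a subspace of `L²_res`, in the sockets `S = homRangeSum ρ_K (E)` = the `E`-isotypic part of `L²_res|_K` for an irreducible
finite-dimensional `K`-type `E`, ★ `Representation.homRangeSum`; one FIXED choice `(ν_N i, 𝓕 i)` of a Haar measure and a fundamental domain of `N_i(K)` per radical):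
* (H4-a) REGULARITY `hreg : ∀ w ∈ S, ∃ ψ, Continuous ψ ∧ ∃ hψ : MemLp ψ 2 μ, hψ.toLp ψ = w` — every vector of `S` has a CONTINUOUS square-integrable representative
  [HarishChandra1968, Lemma «φ = φ ∗ α»; Borel, *Automorphic forms on SL₂(ℝ)*, 2.14; BorelJacquet1979 §4.3] (print: `K`-finite `Z`-finite `L²` residual vectors are automorphic forms);
* (H4-b) EXPONENT FINITENESS `hexp : ∃ T ≤ (G(𝔸) → ℂ), FiniteDimensional ℂ T ∧ ∀ w ∈ S, ∀ ψ (continuous representative of w), ∀ i, (x ↦ ∫_{𝓕 i} ψ((xu⁻¹)Q) dν_N i(u)) ∈ T` — the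
  constant terms of the `K`-type-`E` residual forms lie in ONE finite-dimensional space: finitely many cuspidal exponents `(χ, s)` along the rank-one torus, the FINITENESS
  clause of Langlands' rank-one Eisenstein theory [MoeglinWaldspurger1995, IV.1.11, V.3.13; Langlands1976, §7].

WHAT.
* §1 GENERIC (any ★ `AdelicGroupData` 𝒢 with automorphic `μ`, any ★ `ParabolicUnipotentData` 𝔓): (E1) `exists_bound_constantTermIntegrand` ∕ `integrableOn_constantTerm_of_continuous`
  — for CONTINUOUS `ψ` the constant-term integrand `u ↦ ψ((xu⁻¹)Q)` is BOUNDED on `N_i(𝔸)` (it is `N_i(K)`-periodic, ★ `constantTermIntegrand_mul_left`, and `N_i(K)` has a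
  compact fundamental SET `C`), hence integrable on every fundamental domain of `N_i(K)` for every Haar measure (★ p855468 `finiteCovolume_of_isCompact`); (E2)
  `constantTermVanishes_of_setIntegral_eq_zero` — if the constant term of a continuous `ψ` vanishes at ONE `(ν₀, 𝓕₀)` then ★ `ConstantTermVanishes 𝔓 ψ i` (all Borel
  structures are `borel`; every Haar `ν = c • ν₀`, Mathlib `isMulLeftInvariant_eq_smul`; every `𝓕`, ★ `setIntegral_constantTerm_eq_of_isFundamentalDomain`); (FD)
  **`finiteDimensional_of_reg_exp`** — (H4-a) + (H4-b) ⟹ `FiniteDimensional ℂ S`: the map `w ↦ (i ↦ CT_i ψ_w) : S →ₗ[ℂ] (𝔓.ι → T)` is LINEAR (continuous representatives are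
  UNIQUE, `μ` is positive on opens — Mathlib `Continuous.ae_eq_iff_eq` — and (E1) for `integral_add`) and INJECTIVE (all `CT_i ψ_w = 0` ⟹ (E2) ⟹ `ψ_w ∈` ★ `cuspForms` ⟹ ★
  `toLp_mem_cuspidalSubspace` ⟹ `w ∈ L²_cusp ⊓ (L²_cusp)ᗮ = ⊥`, ★ `isOrtho_cuspidalSubspace_residualSubspace`), and `𝔓.ι → T` is finite-dimensional for `Finite 𝔓.ι`.
* §2 `U(Φ₂)` ∕ `U(Φ₃)`: the lattice data are ★ (`countable_rational_cmParabolicData(R)…`, `exists_isCompact_rational_smul_mem_siegel∕heisenberg`, `isClosed_cmParabolicData(R)_radical_…`),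
  the index types `{k // 1 ≤ k ∧ 2k ≤ N}` are finite; **`cmResidualSpectrumCompact_two_of_reg_exp : CmResidualSpectrumCompact L 2 μ`** (socket 5Res's matrix, via ★ GENERIC
  `residualSpectrumCompact_of_admissible` at `cmParabolicData L 2`) and **`cmResidualSpectrumCompactR_three_of_reg_exp : CmResidualSpectrumCompactR L 3 μ`** (12R3's) from
  (H4-a) + (H4-b) stated per irreducible finite-dimensional `K`-type `E` of `L²_res|_K` (`K` compact Hausdorff, `ιK : K →* U(Φ_N)(𝔸_{L⁺})` continuous — print `K_∞K_f`).
* BY NAME (companion file `K2E1ResidualAdmissibleOfExponentsSigs`): `sig_K2E1ResidualCompactU2_of_reg_exp` ∕ `sig_K2E1ResidualCompactU3R_of_reg_exp` conclude the Sigs ED. 12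
  statements :247 ∕ :293 VERBATIM from the `∀ L μ`-package «for every Borel structure on the radical, ∃ (K, ιK, ν_N, 𝓕) with (H4-a) ∧ (H4-b) for every `K`-type».
HONEST LABEL: HC_CM is proved only modulo the 7 printed citations (2 remaining named inputs: hLiu418 = `stmt-HodgeConjecture-24832`, h413 =
`stmt-HodgeConjecture-24833`) until rung 0 closes; this file asserts no named fact and closes no socket — 5Res ∕ 12R3 now read «⟸ (H4-a) regularity + (H4-b) exponent
finiteness», the honest XL being rank-one Borel Eisenstein theory for `U(Φ₂)` ∕ `U(Φ₃)` (junction K2Liu at `m = 1`).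
References: [MoeglinWaldspurger1995] C. Mœglin, J.-L. Waldspurger, *Spectral Decomposition and Eisenstein Series* (1995), I.2.6, I.2.18, IV.1.11, V.3.13 · [Langlands1976]
R. P. Langlands, LNM 544 (1976), §7 · [HarishChandra1968] Harish-Chandra, LNM 62 (1968), Thm. 1 and Lemma «φ = φ∗α» · [BorelJacquet1979] A. Borel, H. Jacquet, PSPM 33.1
(1979), §4.3–4.6 · [Rogawski1990] J. D. Rogawski, Ann. of Math. Stud. 123 (1990), §13.5 pp. 204–206, §13.9 p. 227.
-/

set_option autoImplicit false
-- the mandated namespace repeats the single-problem summit's segment (`HodgeConjecture.HodgeConjecture`)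
set_option linter.dupNamespace false

noncomputable section

open MeasureTheory Measure Filter Topology Set NumberField IsDedekindDomain
open scoped ENNReal NNReal Pointwise
open Literature.NumberTheory.Automorphic Literature.NumberTheory.Automorphic.UnitaryGroup AdelicGroupData
open Summit.HodgeConjecture.HodgeConjecture.Cruxes.H413.K2E1CuspidalSpectrumUnitary
open Summit.HodgeConjecture.HodgeConjecture.Cruxes.H413.K2E1PoincareSeriesCuspidalGlueU2 (finiteCovolume_of_isCompact)
open Summit.HodgeConjecture.HodgeConjecture.Cruxes.H413.K2E1SiegelRadicalCocompactU2 (countable_rational_cmParabolicData exists_isCompact_rational_smul_mem_siegel)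
open Summit.HodgeConjecture.HodgeConjecture.Cruxes.H413.K2E1HeisenbergRadicalCocompactU3
  (countable_rational_cmParabolicDataR_three exists_isCompact_rational_smul_mem_heisenberg)
open Summit.HodgeConjecture.HodgeConjecture.Cruxes.H413.K2E1ResidualConstantTermFunctional (setIntegral_constantTerm_eq_of_isFundamentalDomain)
open Summit.HodgeConjecture.HodgeConjecture.Cruxes.H413.K2E1ResidualCompactOfAdmissible (residualSpectrumCompact_of_admissible)
open Summit.HodgeConjecture.HodgeConjecture.Cruxes.H413.K2E1BorelLeviU (isClosed_cmParabolicData_radical_two isClosed_cmParabolicDataR_radical_three)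

namespace Summit.HodgeConjecture.HodgeConjecture.Cruxes.H413.K2E1ResidualAdmissibleOfExponents

/-! ## §1 Generic: (E1) boundedness ∕ integrability of the constant-term integrand, (E2) one vanishing constant term gives them all, (FD) the assembly -/

section Generic

variable {F : Type} [Field F] [NumberField F] (𝒢 : AdelicGroupData.{0} F) (μ : Measure 𝒢.automorphicQuotient) [𝒢.IsAutomorphicMeasure μ]
  (𝔓 : 𝒢.ParabolicUnipotentData)

/-- **(E1) The constant-term integrand of a CONTINUOUS `ψ` is BOUNDED on `N_i(𝔸)`**: `u ↦ ψ((xu⁻¹)Q)` is invariant under `u ↦ δu`, `δ ∈ N_i(K)` (★ `constantTermIntegrand_mul_left`),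
so its values are those on a compact fundamental SET `C` of `N_i(K)` (`N_i(K) • C = N_i(𝔸)`), where the continuous integrand is bounded. [cite: BorelJacquet1979, §4.4] [cite: MoeglinWaldspurger1995, I.2.6] -/
theorem exists_bound_constantTermIntegrand {i : 𝔓.ι} {C : Set (𝔓.radical i)} (hC : IsCompact C)
    (hcov : ∀ u : 𝔓.radical i, ∃ l : 𝔓.rational i, l • u ∈ C) {ψ : 𝒢.automorphicQuotient → ℂ} (hψ : Continuous ψ) (x : 𝒢.Adelic) :
    ∃ M : ℝ, ∀ u : 𝔓.radical i, ‖ψ (𝒢.toAutomorphicQuotient (x * (u : 𝒢.Adelic)⁻¹))‖ ≤ M := by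
  have hIc : Continuous fun u : 𝔓.radical i => ψ (𝒢.toAutomorphicQuotient (x * (u : 𝒢.Adelic)⁻¹)) :=
    hψ.comp (𝒢.continuous_toAutomorphicQuotient.comp (continuous_const.mul continuous_subtype_val.inv))
  obtain ⟨M, hM⟩ := hC.exists_bound_of_continuousOn hIc.continuousOn
  refine ⟨M, fun u => ?_⟩
  obtain ⟨l, hl⟩ := hcov u
  rw [← constantTermIntegrand_mul_left ψ x l.2 u]
  exact hM _ hl

/-- **(E1) INTEGRABILITY**: for a continuous `ψ`, the constant-term integrand `u ↦ ψ((xu⁻¹)Q)` is integrable on EVERY fundamental domain of `N_i(K)` for EVERY Haar measure of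
`N_i(𝔸)` (bounded by the previous statement; fundamental domains have finite measure, ★ p855468 `finiteCovolume_of_isCompact`). [cite: BorelJacquet1979, §4.4] [cite: MoeglinWaldspurger1995, I.2.6] -/
theorem integrableOn_constantTerm_of_continuous {i : 𝔓.ι} {m₀ : MeasurableSpace (𝔓.radical i)} [BorelSpace (𝔓.radical i)] [Countable (𝔓.rational i)]
    {C : Set (𝔓.radical i)} (hC : IsCompact C) (hcov : ∀ u : 𝔓.radical i, ∃ l : 𝔓.rational i, l • u ∈ C)
    (ν : Measure (𝔓.radical i)) [ν.IsHaarMeasure] {𝓕 : Set (𝔓.radical i)} (h𝓕 : IsFundamentalDomain (𝔓.rational i) 𝓕 ν)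
    {ψ : 𝒢.automorphicQuotient → ℂ} (hψ : Continuous ψ) (x : 𝒢.Adelic) :
    IntegrableOn (fun u : 𝔓.radical i => ψ (𝒢.toAutomorphicQuotient (x * (u : 𝒢.Adelic)⁻¹))) 𝓕 ν := by
  obtain ⟨M, hM⟩ := exists_bound_constantTermIntegrand 𝒢 𝔓 hC hcov hψ x
  have hIc : Continuous fun u : 𝔓.radical i => ψ (𝒢.toAutomorphicQuotient (x * (u : 𝒢.Adelic)⁻¹)) :=
    hψ.comp (𝒢.continuous_toAutomorphicQuotient.comp (continuous_const.mul continuous_subtype_val.inv))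
  exact Measure.integrableOn_of_bounded (finiteCovolume_of_isCompact 𝔓 i C hC hcov ν 𝓕 h𝓕).ne hIc.aestronglyMeasurable (Eventually.of_forall hM)

/-- **(E2) ONE VANISHING CONSTANT TERM GIVES THEM ALL.**  If `ψ` is continuous and for ONE Haar measure `ν₀` of `N_i(𝔸)` and ONE fundamental domain `𝓕₀` of `N_i(K)` the constant
terms `∫_{𝓕₀} ψ((xu⁻¹)Q) dν₀(u)` vanish for all `x`, then ★ `ConstantTermVanishes 𝔓 ψ i` (every Borel structure — they all equal `borel` —, every Haar `ν` — a multiple of `ν₀` by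
Haar uniqueness, Mathlib `isMulLeftInvariant_eq_smul` —, every fundamental domain `𝓕` — ★ `setIntegral_constantTerm_eq_of_isFundamentalDomain` —, with the integrability of (E1)).
[cite: BorelJacquet1979, §4.4] [cite: MoeglinWaldspurger1995, I.2.6] -/
theorem constantTermVanishes_of_setIntegral_eq_zero {i : 𝔓.ι} {m₀ : MeasurableSpace (𝔓.radical i)} [h₀ : BorelSpace (𝔓.radical i)]
    [LocallyCompactSpace (𝔓.radical i)] [SecondCountableTopology (𝔓.radical i)] [Countable (𝔓.rational i)]
    {C : Set (𝔓.radical i)} (hC : IsCompact C) (hcov : ∀ u : 𝔓.radical i, ∃ l : 𝔓.rational i, l • u ∈ C)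
    (ν₀ : Measure (𝔓.radical i)) [ν₀.IsHaarMeasure] {𝓕₀ : Set (𝔓.radical i)} (h𝓕₀ : IsFundamentalDomain (𝔓.rational i) 𝓕₀ ν₀)
    {ψ : 𝒢.automorphicQuotient → ℂ} (hψ : Continuous ψ)
    (hzero : ∀ x : 𝒢.Adelic, ∫ u in 𝓕₀, ψ (𝒢.toAutomorphicQuotient (x * (u : 𝒢.Adelic)⁻¹)) ∂ν₀ = 0) :
    ConstantTermVanishes 𝔓 ψ i := by
  intro m hm ν hν 𝓕 h𝓕 x
  -- all Borel structures coincide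
  have hmm : m = m₀ := by rw [@BorelSpace.measurable_eq _ _ m hm, @BorelSpace.measurable_eq _ _ m₀ h₀]
  subst hmm
  refine ⟨integrableOn_constantTerm_of_continuous 𝒢 𝔓 hC hcov ν h𝓕 hψ x, ?_⟩
  -- `ν = c • ν₀`
  have hν : ν = ν.haarScalarFactor ν₀ • ν₀ := isMulLeftInvariant_eq_smul ν ν₀
  have hac : ν ≪ ν₀ := by
    rw [hν]
    exact Measure.smul_absolutelyContinuous
  -- move to `𝓕₀` (a fundamental domain for `ν` as well), then scale
  rw [setIntegral_constantTerm_eq_of_isFundamentalDomain 𝔓 ψ ν h𝓕 (h𝓕₀.mono hac) x, hν, Measure.restrict_smul,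
    integral_smul_nnreal_measure, hzero x, smul_zero]

/-- **(FD) THE ASSEMBLY.**  `𝒢` any adelic group datum with automorphic `μ`, `𝔓` radicals with finitely many indices, each `N_i(K)` countable with a compact fundamental SET in the locally
compact second countable `N_i(𝔸)`; fix one Haar measure `ν_N i` and one fundamental domain `𝓕 i` per index.  Let `S` be a subspace of `L²_res` (★ `residualSubspace`) such that
(H4-a) every `w ∈ S` has a CONTINUOUS square-integrable representative `ψ_w`, and (H4-b) the constant terms `x ↦ ∫_{𝓕 i} ψ_w((xu⁻¹)Q) dν_N i` of these representatives lie in ONE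
finite-dimensional space `T` of functions on `G(𝔸)`.  THEN `S` IS FINITE-DIMENSIONAL: `w ↦ (i ↦ CT_i ψ_w)` is a LINEAR map `S → (𝔓.ι → T)` (representatives are unique since `μ` is
positive on opens, and (E1) makes the constant term additive) which is INJECTIVE — if all `CT_i ψ_w` vanish then `ψ_w` is a cusp form by (E2) (★ `cuspForms`), so `w ∈ L²_cusp` (★
`toLp_mem_cuspidalSubspace`) while `w ∈ L²_res ⊥ L²_cusp` (★ `isOrtho_cuspidalSubspace_residualSubspace`), whence `w = 0`.  Applied to `S = homRangeSum(E)` this is the `hadm` binder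
of ★ p856793. [cite: MoeglinWaldspurger1995, I.2.18 and V.3.13] [cite: HarishChandra1968, Thm. 1] [cite: Langlands1976, §7] -/
theorem finiteDimensional_of_reg_exp [Finite 𝔓.ι] [∀ i, MeasurableSpace (𝔓.radical i)] [∀ i, BorelSpace (𝔓.radical i)]
    [∀ i, LocallyCompactSpace (𝔓.radical i)] [∀ i, SecondCountableTopology (𝔓.radical i)] [∀ i, Countable (𝔓.rational i)]
    (C : ∀ i, Set (𝔓.radical i)) (hC : ∀ i, IsCompact (C i)) (hcov : ∀ i (u : 𝔓.radical i), ∃ l : 𝔓.rational i, l • u ∈ C i)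
    (νN : ∀ i, Measure (𝔓.radical i)) [∀ i, (νN i).IsHaarMeasure] (𝓕 : ∀ i, Set (𝔓.radical i))
    (h𝓕 : ∀ i, IsFundamentalDomain (𝔓.rational i) (𝓕 i) (νN i))
    (S : Submodule ℂ (residualSubspace 𝒢 μ 𝔓).toSubmodule)
    (hreg : ∀ w ∈ S, ∃ ψ : 𝒢.automorphicQuotient → ℂ, Continuous ψ ∧ ∃ hψ : MemLp ψ 2 μ,
      hψ.toLp ψ = ((w : (residualSubspace 𝒢 μ 𝔓).toSubmodule) : 𝒢.L2 μ))
    (hexp : ∃ T : Submodule ℂ (𝒢.Adelic → ℂ), FiniteDimensional ℂ T ∧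
      ∀ w ∈ S, ∀ ψ : 𝒢.automorphicQuotient → ℂ, Continuous ψ → ∀ hψ : MemLp ψ 2 μ,
        hψ.toLp ψ = ((w : (residualSubspace 𝒢 μ 𝔓).toSubmodule) : 𝒢.L2 μ) →
          ∀ i : 𝔓.ι, (fun x : 𝒢.Adelic => ∫ u in 𝓕 i, ψ (𝒢.toAutomorphicQuotient (x * (u : 𝒢.Adelic)⁻¹)) ∂(νN i)) ∈ T) :
    FiniteDimensional ℂ S := by
  classical
  obtain ⟨T, hTfd, hT⟩ := hexp
  choose ψ hψc hψm hψe using hreg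
  -- uniqueness of continuous representatives makes `w ↦ ψ_w` additive and homogeneous
  have hψ_add : ∀ w₁ w₂ : S, ψ (w₁ + w₂).1 (w₁ + w₂).2 = ψ w₁.1 w₁.2 + ψ w₂.1 w₂.2 := by
    intro w₁ w₂
    refine (Continuous.ae_eq_iff_eq μ (hψc _ _) ((hψc _ _).add (hψc _ _))).1 ?_
    refine (MemLp.toLp_eq_toLp_iff (hψm (w₁ + w₂).1 (w₁ + w₂).2) ((hψm w₁.1 w₁.2).add (hψm w₂.1 w₂.2))).1 ?_
    rw [MemLp.toLp_add (hψm w₁.1 w₁.2) (hψm w₂.1 w₂.2), hψe w₁.1 w₁.2, hψe w₂.1 w₂.2, hψe (w₁ + w₂).1 (w₁ + w₂).2]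
    rfl
  have hψ_smul : ∀ (a : ℂ) (w : S), ψ (a • w).1 (a • w).2 = a • ψ w.1 w.2 := by
    intro a w
    refine (Continuous.ae_eq_iff_eq μ (hψc _ _) ((hψc _ _).const_smul a)).1 ?_
    refine (MemLp.toLp_eq_toLp_iff (hψm (a • w).1 (a • w).2) ((hψm w.1 w.2).const_smul a)).1 ?_
    rw [MemLp.toLp_const_smul a (hψm w.1 w.2), hψe w.1 w.2, hψe (a • w).1 (a • w).2]
    rfl
  -- the constant-term map `S → (ι → T)`
  have hmemT : ∀ (w : S) (i : 𝔓.ι),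
      (fun x : 𝒢.Adelic => ∫ u in 𝓕 i, ψ w.1 w.2 (𝒢.toAutomorphicQuotient (x * (u : 𝒢.Adelic)⁻¹)) ∂(νN i)) ∈ T :=
    fun w i => hT w.1 w.2 (ψ w.1 w.2) (hψc _ _) (hψm _ _) (hψe _ _) i
  let Φ : S →ₗ[ℂ] (𝔓.ι → T) :=
    { toFun := fun w i => ⟨fun x => ∫ u in 𝓕 i, ψ w.1 w.2 (𝒢.toAutomorphicQuotient (x * (u : 𝒢.Adelic)⁻¹)) ∂(νN i), hmemT w i⟩
      map_add' := fun w₁ w₂ => by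
        funext i
        apply Subtype.ext
        change (fun x => ∫ u in 𝓕 i, ψ (w₁ + w₂).1 (w₁ + w₂).2 (𝒢.toAutomorphicQuotient (x * (u : 𝒢.Adelic)⁻¹)) ∂(νN i)) =
          (fun x => ∫ u in 𝓕 i, ψ w₁.1 w₁.2 (𝒢.toAutomorphicQuotient (x * (u : 𝒢.Adelic)⁻¹)) ∂(νN i)) +
            fun x => ∫ u in 𝓕 i, ψ w₂.1 w₂.2 (𝒢.toAutomorphicQuotient (x * (u : 𝒢.Adelic)⁻¹)) ∂(νN i)
        funext x
        rw [hψ_add, Pi.add_apply]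
        exact integral_add (integrableOn_constantTerm_of_continuous 𝒢 𝔓 (hC i) (hcov i) (νN i) (h𝓕 i) (hψc _ _) x)
          (integrableOn_constantTerm_of_continuous 𝒢 𝔓 (hC i) (hcov i) (νN i) (h𝓕 i) (hψc _ _) x)
      map_smul' := fun a w => by
        funext i
        apply Subtype.ext
        change (fun x => ∫ u in 𝓕 i, ψ (a • w).1 (a • w).2 (𝒢.toAutomorphicQuotient (x * (u : 𝒢.Adelic)⁻¹)) ∂(νN i)) =
          a • fun x => ∫ u in 𝓕 i, ψ w.1 w.2 (𝒢.toAutomorphicQuotient (x * (u : 𝒢.Adelic)⁻¹)) ∂(νN i)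
        funext x
        rw [hψ_smul, Pi.smul_apply]
        exact integral_smul a _ }
  -- injectivity
  haveI : FiniteDimensional ℂ T := hTfd
  refine FiniteDimensional.of_injective Φ ((injective_iff_map_eq_zero Φ).2 fun w hw => ?_)
  have hzero : ∀ (i : 𝔓.ι) (x : 𝒢.Adelic), ∫ u in 𝓕 i, ψ w.1 w.2 (𝒢.toAutomorphicQuotient (x * (u : 𝒢.Adelic)⁻¹)) ∂(νN i) = 0 :=
    fun i x => congrFun (congrArg Subtype.val (congrFun hw i)) x
  have hCTV : ∀ i : 𝔓.ι, ConstantTermVanishes 𝔓 (ψ w.1 w.2) i := fun i =>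
    -- explicit form: the conclusion is the `∀ [MeasurableSpace] [BorelSpace] …`-quantified ★ predicate itself, not an instance of it
    @constantTermVanishes_of_setIntegral_eq_zero F _ _ 𝒢 𝔓 i _ _ _ _ _ (C i) (hC i) (hcov i) (νN i) _ (𝓕 i) (h𝓕 i)
      (ψ w.1 w.2) (hψc w.1 w.2) (hzero i)
  have hcusp : ψ w.1 w.2 ∈ 𝒢.cuspForms μ 𝔓 := ⟨hψc _ _, hψm _ _, hCTV⟩
  have h1 : ((w : S) : (residualSubspace 𝒢 μ 𝔓).toSubmodule).1 ∈ (𝒢.cuspidalSubspace μ 𝔓).toSubmodule := by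
    rw [← hψe w.1 w.2]
    exact toLp_mem_cuspidalSubspace hcusp
  have h2 : ((w : S) : (residualSubspace 𝒢 μ 𝔓).toSubmodule).1 ∈ (𝒢.cuspidalSubspace μ 𝔓).toSubmoduleᗮ :=
    (isOrtho_cuspidalSubspace_residualSubspace 𝒢 μ 𝔓).symm ((w : S) : (residualSubspace 𝒢 μ 𝔓).toSubmodule).2
  have h3 : ((w : S) : (residualSubspace 𝒢 μ 𝔓).toSubmodule).1 ∈ (𝒢.cuspidalSubspace μ 𝔓).toSubmodule ⊓ (𝒢.cuspidalSubspace μ 𝔓).toSubmoduleᗮ := ⟨h1, h2⟩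
  rw [Submodule.inf_orthogonal_eq_bot, Submodule.mem_bot] at h3
  exact Subtype.ext (Subtype.ext h3)

end Generic

/-! ## §2 `U(Φ₂)` (socket 5Res) and `U(Φ₃)` (socket 12R3): the sockets from (H4-a) + (H4-b) per `K`-type -/

section Unitary

variable (L : Type) [Field L] [NumberField L] [IsCMField L]

/-- The index type `{k // 1 ≤ k ∧ 2k ≤ N}` of ★ `cmParabolicData` ∕ ★ `cmParabolicDataR` is finite (it embeds in `Fin (N + 1)`). [folklore] -/
theorem finite_index (N : ℕ) : Finite {k : ℕ // 1 ≤ k ∧ 2 * k ≤ N} :=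
  Finite.of_injective (fun k : {k : ℕ // 1 ≤ k ∧ 2 * k ≤ N} => (⟨k.1, by have := k.2.2; omega⟩ : Fin (N + 1)))
    fun a b h => Subtype.ext (Fin.val_eq_of_eq h)

/-- **SOCKET 5Res `sig_K2E1ResidualCompactU2` ⟸ (H4-a) + (H4-b).**  For `U(Φ₂)` over the CM field `L`, an automorphic `μ`, a Borel structure on the Siegel radical, a compact Hausdorff
`K` with continuous `ιK : K →* U(Φ₂)(𝔸_{L⁺})` (print `K_∞K_f`), ONE Haar measure and ONE fundamental domain of `N(L⁺)` on the radical: if for every irreducible finite-dimensional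
`K`-type `E` of `L²_res|_K` the `E`-isotypic vectors have continuous representatives (H4-a) whose constant terms span a finite-dimensional space (H4-b), then ★
`CmResidualSpectrumCompact L 2 μ` (= `R(f)|_{L²_res}` compact).  §1 (FD) feeds ★ `residualSpectrumCompact_of_admissible`; the lattice data are ★
(`countable_rational_cmParabolicData`, `exists_isCompact_rational_smul_mem_siegel`, `isClosed_cmParabolicData_radical_two`).
[cite: MoeglinWaldspurger1995, I.2.18 and V.3.13] [cite: HarishChandra1968, Thm. 1] [cite: Rogawski1990, §13.5 pp. 204–206] -/
theorem cmResidualSpectrumCompact_two_of_reg_exp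
    (μ : Measure (cmDatum L 2 (Matrix.of fun i j : Fin 2 => if i.val + j.val + 1 = 2 then (1 : L) else 0)).automorphicQuotient)
    [(cmDatum L 2 (Matrix.of fun i j : Fin 2 => if i.val + j.val + 1 = 2 then (1 : L) else 0)).IsAutomorphicMeasure μ]
    [∀ i, MeasurableSpace ((cmParabolicData L 2).radical i)] [∀ i, BorelSpace ((cmParabolicData L 2).radical i)]
    {K : Type*} [Group K] [TopologicalSpace K] [IsTopologicalGroup K] [CompactSpace K] [T2Space K]
    (ιK : K →* (cmDatum L 2 (Matrix.of fun i j : Fin 2 => if i.val + j.val + 1 = 2 then (1 : L) else 0)).Adelic) (hι : Continuous ιK)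
    (νN : ∀ i, Measure ((cmParabolicData L 2).radical i)) [∀ i, (νN i).IsHaarMeasure] (𝓕 : ∀ i, Set ((cmParabolicData L 2).radical i))
    (h𝓕 : ∀ i, IsFundamentalDomain ((cmParabolicData L 2).rational i) (𝓕 i) (νN i))
    (hreg : ∀ (E : Submodule ℂ (cmResidualSubspace L 2 μ).toSubmodule) (hE : ∀ k, ∀ x ∈ E, ((cmResidualSubspace L 2 μ).toContRep.restrict ιK) k x ∈ E),
      FiniteDimensional ℂ E → (((cmResidualSubspace L 2 μ).toContRep.restrict ιK).subRep E hE).IsIrreducible →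
      ∀ w ∈ Representation.homRangeSum ((cmResidualSubspace L 2 μ).toContRep.restrict ιK).toRepresentation
          (((cmResidualSubspace L 2 μ).toContRep.restrict ιK).subRep E hE),
        ∃ ψ : (cmDatum L 2 (Matrix.of fun i j : Fin 2 => if i.val + j.val + 1 = 2 then (1 : L) else 0)).automorphicQuotient → ℂ, Continuous ψ ∧ ∃ hψ : MemLp ψ 2 μ,
          hψ.toLp ψ = ((w : (cmResidualSubspace L 2 μ).toSubmodule) : (cmDatum L 2 (Matrix.of fun i j : Fin 2 => if i.val + j.val + 1 = 2 then (1 : L) else 0)).L2 μ))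
    (hexp : ∀ (E : Submodule ℂ (cmResidualSubspace L 2 μ).toSubmodule) (hE : ∀ k, ∀ x ∈ E, ((cmResidualSubspace L 2 μ).toContRep.restrict ιK) k x ∈ E),
      FiniteDimensional ℂ E → (((cmResidualSubspace L 2 μ).toContRep.restrict ιK).subRep E hE).IsIrreducible →
      ∃ T : Submodule ℂ ((cmDatum L 2 (Matrix.of fun i j : Fin 2 => if i.val + j.val + 1 = 2 then (1 : L) else 0)).Adelic → ℂ), FiniteDimensional ℂ T ∧
        ∀ w ∈ Representation.homRangeSum ((cmResidualSubspace L 2 μ).toContRep.restrict ιK).toRepresentation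
            (((cmResidualSubspace L 2 μ).toContRep.restrict ιK).subRep E hE),
          ∀ ψ : (cmDatum L 2 (Matrix.of fun i j : Fin 2 => if i.val + j.val + 1 = 2 then (1 : L) else 0)).automorphicQuotient → ℂ, Continuous ψ → ∀ hψ : MemLp ψ 2 μ,
            hψ.toLp ψ = ((w : (cmResidualSubspace L 2 μ).toSubmodule) : (cmDatum L 2 (Matrix.of fun i j : Fin 2 => if i.val + j.val + 1 = 2 then (1 : L) else 0)).L2 μ) →
              ∀ i, (fun x => ∫ u in 𝓕 i, ψ ((cmDatum L 2 (Matrix.of fun i j : Fin 2 => if i.val + j.val + 1 = 2 then (1 : L) else 0)).toAutomorphicQuotient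
                (x * (u : (cmDatum L 2 (Matrix.of fun i j : Fin 2 => if i.val + j.val + 1 = 2 then (1 : L) else 0)).Adelic)⁻¹)) ∂(νN i)) ∈ T) :
    CmResidualSpectrumCompact L 2 μ :=
  residualSpectrumCompact_of_admissible _ μ (cmParabolicData L 2) ιK hι fun E hE hfd hirr => by
    haveI : ∀ i, Countable ((cmParabolicData L 2).rational i) := fun i => countable_rational_cmParabolicData L i
    haveI : ∀ i, LocallyCompactSpace ((cmParabolicData L 2).radical i) := fun i => (isClosed_cmParabolicData_radical_two L i).locallyCompactSpace
    haveI : ∀ i, SecondCountableTopology ((cmParabolicData L 2).radical i) := fun i => TopologicalSpace.Subtype.secondCountableTopology _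
    haveI : Finite (cmParabolicData L 2).ι := finite_index 2
    have hcpt : ∀ i : (cmParabolicData L 2).ι, ∃ C : Set ((cmParabolicData L 2).radical i), IsCompact C ∧
        ∀ u : (cmParabolicData L 2).radical i, ∃ l : (cmParabolicData L 2).rational i, l • u ∈ C := by
      intro i
      obtain ⟨k, hk⟩ := i
      obtain rfl : k = 1 := by omega
      exact exists_isCompact_rational_smul_mem_siegel L (antidiagOne_eq_over (L := L) (N := 2)).symm
    choose C hC hcov using hcpt
    exact finiteDimensional_of_reg_exp _ μ (cmParabolicData L 2) C hC hcov νN 𝓕 h𝓕 _ (hreg E hE hfd hirr) (hexp E hE hfd hirr)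

/-- **SOCKET 12R3 `sig_K2E1ResidualCompactU3R` ⟸ (H4-a) + (H4-b)** — the same for `U(Φ₃)` along the Heisenberg radical of record (★ `cmParabolicDataR L 3`): ★
`CmResidualSpectrumCompactR L 3 μ` from regularity + exponent finiteness per `K`-type (lattice data ★ `countable_rational_cmParabolicDataR_three`,
`exists_isCompact_rational_smul_mem_heisenberg`, `isClosed_cmParabolicDataR_radical_three`). [cite: MoeglinWaldspurger1995, I.2.18 and V.3.13] [cite: HarishChandra1968, Thm. 1] [cite: Rogawski1990, §13.9 p. 227] -/
theorem cmResidualSpectrumCompactR_three_of_reg_exp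
    (μ : Measure (cmDatum L 3 (Matrix.of fun i j : Fin 3 => if i.val + j.val + 1 = 3 then (1 : L) else 0)).automorphicQuotient)
    [(cmDatum L 3 (Matrix.of fun i j : Fin 3 => if i.val + j.val + 1 = 3 then (1 : L) else 0)).IsAutomorphicMeasure μ]
    [∀ i, MeasurableSpace ((cmParabolicDataR L 3).radical i)] [∀ i, BorelSpace ((cmParabolicDataR L 3).radical i)]
    {K : Type*} [Group K] [TopologicalSpace K] [IsTopologicalGroup K] [CompactSpace K] [T2Space K]
    (ιK : K →* (cmDatum L 3 (Matrix.of fun i j : Fin 3 => if i.val + j.val + 1 = 3 then (1 : L) else 0)).Adelic) (hι : Continuous ιK)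
    (νN : ∀ i, Measure ((cmParabolicDataR L 3).radical i)) [∀ i, (νN i).IsHaarMeasure] (𝓕 : ∀ i, Set ((cmParabolicDataR L 3).radical i))
    (h𝓕 : ∀ i, IsFundamentalDomain ((cmParabolicDataR L 3).rational i) (𝓕 i) (νN i))
    (hreg : ∀ (E : Submodule ℂ (cmResidualSubspaceR L 3 μ).toSubmodule) (hE : ∀ k, ∀ x ∈ E, ((cmResidualSubspaceR L 3 μ).toContRep.restrict ιK) k x ∈ E),
      FiniteDimensional ℂ E → (((cmResidualSubspaceR L 3 μ).toContRep.restrict ιK).subRep E hE).IsIrreducible →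
      ∀ w ∈ Representation.homRangeSum ((cmResidualSubspaceR L 3 μ).toContRep.restrict ιK).toRepresentation
          (((cmResidualSubspaceR L 3 μ).toContRep.restrict ιK).subRep E hE),
        ∃ ψ : (cmDatum L 3 (Matrix.of fun i j : Fin 3 => if i.val + j.val + 1 = 3 then (1 : L) else 0)).automorphicQuotient → ℂ, Continuous ψ ∧ ∃ hψ : MemLp ψ 2 μ,
          hψ.toLp ψ = ((w : (cmResidualSubspaceR L 3 μ).toSubmodule) : (cmDatum L 3 (Matrix.of fun i j : Fin 3 => if i.val + j.val + 1 = 3 then (1 : L) else 0)).L2 μ))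
    (hexp : ∀ (E : Submodule ℂ (cmResidualSubspaceR L 3 μ).toSubmodule) (hE : ∀ k, ∀ x ∈ E, ((cmResidualSubspaceR L 3 μ).toContRep.restrict ιK) k x ∈ E),
      FiniteDimensional ℂ E → (((cmResidualSubspaceR L 3 μ).toContRep.restrict ιK).subRep E hE).IsIrreducible →
      ∃ T : Submodule ℂ ((cmDatum L 3 (Matrix.of fun i j : Fin 3 => if i.val + j.val + 1 = 3 then (1 : L) else 0)).Adelic → ℂ), FiniteDimensional ℂ T ∧
        ∀ w ∈ Representation.homRangeSum ((cmResidualSubspaceR L 3 μ).toContRep.restrict ιK).toRepresentation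
            (((cmResidualSubspaceR L 3 μ).toContRep.restrict ιK).subRep E hE),
          ∀ ψ : (cmDatum L 3 (Matrix.of fun i j : Fin 3 => if i.val + j.val + 1 = 3 then (1 : L) else 0)).automorphicQuotient → ℂ, Continuous ψ → ∀ hψ : MemLp ψ 2 μ,
            hψ.toLp ψ = ((w : (cmResidualSubspaceR L 3 μ).toSubmodule) : (cmDatum L 3 (Matrix.of fun i j : Fin 3 => if i.val + j.val + 1 = 3 then (1 : L) else 0)).L2 μ) →
              ∀ i, (fun x => ∫ u in 𝓕 i, ψ ((cmDatum L 3 (Matrix.of fun i j : Fin 3 => if i.val + j.val + 1 = 3 then (1 : L) else 0)).toAutomorphicQuotient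
                (x * (u : (cmDatum L 3 (Matrix.of fun i j : Fin 3 => if i.val + j.val + 1 = 3 then (1 : L) else 0)).Adelic)⁻¹)) ∂(νN i)) ∈ T) :
    CmResidualSpectrumCompactR L 3 μ :=
  residualSpectrumCompact_of_admissible _ μ (cmParabolicDataR L 3) ιK hι fun E hE hfd hirr => by
    haveI : ∀ i, Countable ((cmParabolicDataR L 3).rational i) := fun i => countable_rational_cmParabolicDataR_three L i
    haveI : ∀ i, LocallyCompactSpace ((cmParabolicDataR L 3).radical i) := fun i => (isClosed_cmParabolicDataR_radical_three L i).locallyCompactSpace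
    haveI : ∀ i, SecondCountableTopology ((cmParabolicDataR L 3).radical i) := fun i => TopologicalSpace.Subtype.secondCountableTopology _
    haveI : Finite (cmParabolicDataR L 3).ι := finite_index 3
    have hcpt : ∀ i : (cmParabolicDataR L 3).ι, ∃ C : Set ((cmParabolicDataR L 3).radical i), IsCompact C ∧
        ∀ u : (cmParabolicDataR L 3).radical i, ∃ l : (cmParabolicDataR L 3).rational i, l • u ∈ C := by
      intro i
      obtain ⟨k, hk⟩ := i
      obtain rfl : k = 1 := by omega
      exact exists_isCompact_rational_smul_mem_heisenberg L (antidiagOne_eq_over (L := L) (N := 3)).symm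
    choose C hC hcov using hcpt
    exact finiteDimensional_of_reg_exp _ μ (cmParabolicDataR L 3) C hC hcov νN 𝓕 h𝓕 _ (hreg E hE hfd hirr) (hexp E hE hfd hirr)

end Unitary

end Summit.HodgeConjecture.HodgeConjecture.Cruxes.H413.K2E1ResidualAdmissibleOfExponents

end
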